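import Summits.KontsevichZagierPeriods.KontsevichZagierPeriods.Theorems.RootDecompRelativeModAbsoluteAngleFoldP6

/-! # `RootDecompRelativeModAbsoluteAngleFoldP7` — part 7/9 of the mechanical ≤400-line split of `af_src.lean` (sha256 2a2742458ba4dd14…)
Source: decomp-kz lens-3 g14 AngleFold.lean @5fd37862 (lint-fixed copy @30e24be4 by writer g8 per critic g6-12): ANGLE ADDITION IN FAMILIES — angleCellwiseFoldAt_one : AngleCellwiseFoldAt 1 PROVED (critic CLEARED g6-12 l.1335); --supports stmt-KontsevichZagierPeriods-30572.
Split by census-1 g10 `gen/splitlean.py`: scopes re-opened with their `open`/`variable`/`set_option` context; mathematics and declaration order unchanged. -/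

noncomputable section
open Set MeasureTheory
open Literature.NumberTheory.Transcendental Literature.ModelTheory.ExponentialFields
namespace Summit.KontsevichZagierPeriods.RootDecompRelativeModAbsolute.Rung30571.RegularisedLogLayer.CylLog.Leaf.G13
namespace AngleFold

/-- **Cancellation of the Jacobian monomials**: the constancy of `Σⱼ f'ₛⱼ arctan uⱼ` and `pⱼ = Σₛ q'ₛ f'ₛⱼ` force
`Σⱼ pⱼ(x) uⱼ'(ξ)/(1+uⱼ(ξ)²) = 0`. -/
theorem sum_wfun_eq_zero {T : Set (Fin 1 → ℝ)} (hTo : IsOpen T) {l : ℕ} {p u : Fin l → (Fin 1 → ℝ) → ℝ}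
    (hud : ∀ j, ∀ x ∈ T, DifferentiableAt ℝ (u j) x)
    {S : ℕ} (f' : Fin S → Fin l → ℤ) (m : Fin S → ℚ) (q' : Fin S → (Fin 1 → ℝ) → ℝ)
    (hrel : ∀ s, ∀ x ∈ T, ∑ j, (f' s j : ℝ) * Real.arctan (u j x) = (m s : ℝ) * Real.pi)
    (hpq : ∀ j, ∀ x ∈ T, p j x = ∑ s, q' s x * (f' s j : ℝ)) :
    ∀ z ∈ Rgn T, ∑ j, wfun (p j) (u j) z = 0 := by
  intro z hz
  have hx := hz.1
  have hξ : bpt (z (Fin.last 1)) ∈ T := hz.2.1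
  have hder : ∀ s, ∑ j, (f' s j : ℝ) * (du (u j) (bpt (z (Fin.last 1))) / (1 + u j (bpt (z (Fin.last 1))) ^ 2)) = 0 := by
    intro s
    have h1 : HasDerivAt (fun r => ∑ j, (f' s j : ℝ) * Real.arctan (u j (bpt r)))
        (∑ j, (f' s j : ℝ) * (1 / (1 + u j (bpt (z (Fin.last 1))) ^ 2) * du (u j) (bpt (z (Fin.last 1)))))
        (z (Fin.last 1)) := by
      have h1' := HasDerivAt.sum (u := Finset.univ) (A := fun j r => (f' s j : ℝ) * Real.arctan (u j (bpt r)))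
          (A' := fun j => (f' s j : ℝ) * (1 / (1 + u j (bpt (z (Fin.last 1))) ^ 2) * du (u j) (bpt (z (Fin.last 1)))))
          fun j _ => ((hasDerivAt_comp_bpt (hud j _ hξ)).arctan).const_mul _
      rw [Finset.sum_fn] at h1'
      exact h1'
    have h2 : HasDerivAt (fun r => ∑ j, (f' s j : ℝ) * Real.arctan (u j (bpt r))) 0 (z (Fin.last 1)) := by
      refine (hasDerivAt_const (z (Fin.last 1)) ((m s : ℝ) * Real.pi)).congr_of_eventuallyEq ?_
      exact Filter.eventuallyEq_of_mem ((isOpen_preimage_bpt hTo).mem_nhds hξ) fun r hr => hrel s (bpt r) hr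
    have := h1.unique h2
    rw [← this]
    exact Finset.sum_congr rfl fun j _ => by ring
  calc ∑ j, wfun (p j) (u j) z
        = ∑ j, ∑ s, q' s (Fin.init z) * ((f' s j : ℝ) *
            (du (u j) (bpt (z (Fin.last 1))) / (1 + u j (bpt (z (Fin.last 1))) ^ 2))) := by
          refine Finset.sum_congr rfl fun j _ => ?_
          rw [wfun, hpq j _ hx, Finset.sum_mul, Finset.sum_div]
          exact Finset.sum_congr rfl fun s _ => by ring
    _ = ∑ s, ∑ j, q' s (Fin.init z) * ((f' s j : ℝ) *
            (du (u j) (bpt (z (Fin.last 1))) / (1 + u j (bpt (z (Fin.last 1))) ^ 2))) := Finset.sum_comm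
    _ = ∑ s, q' s (Fin.init z) * ∑ j, (f' s j : ℝ) *
            (du (u j) (bpt (z (Fin.last 1))) / (1 + u j (bpt (z (Fin.last 1))) ^ 2)) := by
          refine Finset.sum_congr rfl fun s _ => by rw [Finset.mul_sum]
    _ = 0 := by simp only [hder, mul_zero, Finset.sum_const_zero]

/-- **The half-cell theorem.** On an open order-convex `ℚ`-sa `T ⊆ ℝ¹` whose TOP end is the bad end (every edge
smooth with a constant derivative sign and on one side of `1`, every coefficient integrable towards the bottom end), an
honest arctangent family carrying the pointwise angle relations `Σⱼ f'ₛⱼ arctan uⱼ = mₛ π`, `Σₛ q'ₛ mₛ = 0`,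
`pⱼ = Σₛ q'ₛ f'ₛⱼ` sums to a relation. -/
theorem half_top {T : Set (Fin 1 → ℝ)} (hT : IsSemialgebraic ℚ T) (hTo : IsOpen T) (hTc : OrdConv T)
    (hne : T.Nonempty) {l : ℕ} {p u : Fin l → (Fin 1 → ℝ) → ℝ}
    (hp : ∀ j, IsSemialgebraicFunOn ℚ T (p j)) (hu : ∀ j, IsSemialgebraicFunOn ℚ T (u j))
    (hu0 : ∀ j, ∀ x ∈ T, 0 ≤ u j x) (hud : ∀ j, ∀ x ∈ T, DifferentiableAt ℝ (u j) x)
    (hsgn : ∀ j, (∀ x ∈ T, du (u j) x = 0) ∨ (∀ x ∈ T, du (u j) x < 0) ∨ (∀ x ∈ T, 0 < du (u j) x))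
    (hone : ∀ j, (∀ x ∈ T, u j x ≤ 1) ∨ (∀ x ∈ T, 1 ≤ u j x))
    (A : Fin l → KZ.IntegralRep 2) (hAd : ∀ j, (A j).domain = KZlog.band T (fun _ => 0) (u j))
    (hAi : ∀ j, EqOn (A j).integrand (fun z => p j (Fin.init z) / (1 + z (Fin.last 1) ^ 2)) (A j).domain)
    (hint : ∀ j, IntegrableOn (fun x => p j x * Real.arctan (u j x)) T)
    (hloc : ∀ j, ∀ x₁ ∈ T, IntegrableOn (p j) {x | x ∈ T ∧ x 0 ≤ x₁ 0})
    {S : ℕ} (f' : Fin S → Fin l → ℤ) (m : Fin S → ℚ) (q' : Fin S → (Fin 1 → ℝ) → ℝ)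
    (hrel : ∀ s, ∀ x ∈ T, ∑ j, (f' s j : ℝ) * Real.arctan (u j x) = (m s : ℝ) * Real.pi)
    (hbud : ∀ x ∈ T, ∑ s, q' s x * (m s : ℝ) = 0)
    (hpq : ∀ j, ∀ x ∈ T, p j x = ∑ s, q' s x * (f' s j : ℝ)) :
    ∑ j, KZ.of (A j) ∈ KZ.relations := by
  classical
  obtain ⟨x₂, hx₂⟩ := hne
  choose dv cv V W hdv0 hdvs hVd hVi hWd hWi hclA hlim using fun j =>
    edge_package hT hTo hTc ⟨x₂, hx₂⟩ (hp j) (hu j) (hu0 j) (hud j) (hsgn j) (hone j) (A j) (hAd j) (hAi j)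
      (hint j) (hloc j)
  -- (1) the Jacobian monomials cancel
  have hRsa : IsSemialgebraic ℚ (Rgn T) := isSemialgebraic_Rgn hT
  obtain ⟨Z, hZd, hZi⟩ := KZ.exists_zeroRep hRsa
  have hWsum : ∑ j, cl (W j) = 0 := by
    have h := KZ.of_sub_of_sub_sum_mem_relations l Z Z W rfl (fun j => by rw [hWd j, hZd]) fun z hz => by
      rw [hZd] at hz
      show Z.integrand z = Z.integrand z + ∑ i, (W i).integrand z
      rw [hZi, Pi.zero_apply, zero_add]
      rw [show ∑ i, (W i).integrand z = ∑ i, wfun (p i) (u i) z from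
        Finset.sum_congr rfl fun i _ => by rw [hWi i]]
      exact (sum_wfun_eq_zero hTo hud f' m q' hrel hpq z hz).symm
    rw [sub_self, zero_sub] at h
    have h' : ∑ j, KZ.of (W j) ∈ KZ.relations := neg_mem_iff.1 h
    have := (mk_eq_zero_iff).2 h'
    rw [map_sum] at this
    exact this
  -- (2) the angle relations pass to the limit
  have hrel' : ∀ s, ∑ jk : Fin l × Fin 3, ((cv jk.1 jk.2 * f' s jk.1 : ℤ) : ℝ) * Real.arctan (dv jk.1 jk.2) =
      (m s : ℝ) * Real.pi := by
    intro s
    set θ : Fin l → ℝ := fun j => ∑ k, (cv j k : ℝ) * Real.arctan (dv j k) with hθ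
    have hL : ∑ jk : Fin l × Fin 3, ((cv jk.1 jk.2 * f' s jk.1 : ℤ) : ℝ) * Real.arctan (dv jk.1 jk.2) =
        ∑ j, (f' s j : ℝ) * θ j := by
      rw [Fintype.sum_prod_type]
      refine Finset.sum_congr rfl fun j _ => ?_
      rw [hθ, Finset.mul_sum]
      exact Finset.sum_congr rfl fun k _ => by push_cast; ring
    rw [hL]
    symm
    refine eq_of_forall_abs_sub_le (C := ∑ j, |(f' s j : ℝ)|) (Finset.sum_nonneg fun j _ => abs_nonneg _)
      fun δ hδ => ?_
    choose x₁ hx₁T hx₁ using fun j => hlim j δ hδ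
    obtain ⟨xm, hxmT, hxm⟩ : ∃ xm ∈ T, ∀ j, x₁ j 0 ≤ xm 0 := by
      rcases isEmpty_or_nonempty (Fin l) with hl | hl
      · exact ⟨x₂, hx₂, fun j => (IsEmpty.false j).elim⟩
      · obtain ⟨j₀, -, hj₀⟩ := Finset.exists_max_image Finset.univ (fun j => x₁ j 0) Finset.univ_nonempty
        exact ⟨x₁ j₀, hx₁T j₀, fun j => hj₀ j (Finset.mem_univ j)⟩
    have h1 := hrel s xm hxmT
    calc |(m s : ℝ) * Real.pi - ∑ j, (f' s j : ℝ) * θ j|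
          = |∑ j, (f' s j : ℝ) * (Real.arctan (u j xm) - θ j)| := by
            rw [← h1, ← Finset.sum_sub_distrib]
            exact congrArg _ (Finset.sum_congr rfl fun j _ => by ring)
      _ ≤ ∑ j, |(f' s j : ℝ) * (Real.arctan (u j xm) - θ j)| := Finset.abs_sum_le_sum_abs _ _
      _ ≤ ∑ j, |(f' s j : ℝ)| * δ := Finset.sum_le_sum fun j _ => by
            rw [abs_mul]
            exact mul_le_mul_of_nonneg_left (hx₁ j xm hxmT (hxm j)).le (abs_nonneg _)
      _ = (∑ j, |(f' s j : ℝ)|) * δ := by rw [Finset.sum_mul]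
  -- (3) the constant-angle fold over `Fin l × Fin 3`
  have hcsa : ∀ jk : Fin l × Fin 3, IsSemialgebraicFunOn ℚ T (fun x => (cv jk.1 jk.2 : ℝ) * p jk.1 x) := fun jk =>
    IsSemialgebraicFunOn.mul_holds ((saConst_ratCast hT (cv jk.1 jk.2 : ℚ)).congr fun _ _ => by simp) (hp jk.1)
  have hV := constAngleFold hT (ι := Fin l × Fin 3) (fun jk => dv jk.1 jk.2)
    (fun jk x => (cv jk.1 jk.2 : ℝ) * p jk.1 x) (fun jk => V jk.1 jk.2) (fun jk => hdv0 _ _) (fun jk => hdvs _ _)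
    hcsa (fun jk => hVd _ _) (fun jk => hVi _ _) (fun s jk => cv jk.1 jk.2 * f' s jk.1) m q' hrel' hbud
    (fun jk x hx => by
      show (cv jk.1 jk.2 : ℝ) * p jk.1 x = ∑ s, q' s x * ((cv jk.1 jk.2 * f' s jk.1 : ℤ) : ℝ)
      rw [hpq jk.1 x hx, Finset.mul_sum]
      exact Finset.sum_congr rfl fun s _ => by push_cast; ring)
  -- (4) assemble in the quotient
  have hVsum : ∑ jk : Fin l × Fin 3, cl (V jk.1 jk.2) = 0 := by
    have := (mk_eq_zero_iff).2 hV
    rw [map_sum] at this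
    exact this
  have hAsum : ∑ j, cl (A j) = 0 := by
    calc ∑ j, cl (A j) = ∑ j, (∑ k, cl (V j k) - cl (W j)) := Finset.sum_congr rfl fun j _ => hclA j
      _ = ∑ j, ∑ k, cl (V j k) - ∑ j, cl (W j) := Finset.sum_sub_distrib _ _
      _ = ∑ jk : Fin l × Fin 3, cl (V jk.1 jk.2) - ∑ j, cl (W j) := by rw [Fintype.sum_prod_type]
      _ = 0 := by rw [hVsum, hWsum, sub_zero]
  apply (mk_eq_zero_iff).1
  rw [map_sum]
  exact hAsum

/-! ### §B6 Reflection `x ↦ -x`: the bottom half-cell from the top one. -/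

/-- A coordinate sign flip as a continuous linear map. -/
noncomputable def flipLin (n : ℕ) (c : Fin n → ℝ) : (Fin n → ℝ) →L[ℝ] (Fin n → ℝ) :=
  LinearMap.toContinuousLinearMap (Matrix.toLin' (Matrix.diagonal c))

/-- Auxiliary step `flipLin_apply` (§B6): flip Lin apply. [bookkeeping] -/
theorem flipLin_apply {n : ℕ} (c : Fin n → ℝ) (z : Fin n → ℝ) (i : Fin n) : flipLin n c z i = c i * z i := by
  show Matrix.toLin' (Matrix.diagonal c) z i = _
  rw [Matrix.toLin'_apply, Matrix.mulVec_diagonal]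

/-- Auxiliary step `det_flipLin` (§B6): det flip Lin. [bookkeeping] -/
theorem det_flipLin {n : ℕ} (c : Fin n → ℝ) : (flipLin n c).det = ∏ i, c i := by
  show LinearMap.det (Matrix.toLin' (Matrix.diagonal c)) = _
  rw [LinearMap.det_toLin', Matrix.det_diagonal]

/-- Auxiliary step `neg_eq_bpt` (§B6): neg eq bpt. [bookkeeping] -/
theorem neg_eq_bpt (x : Fin 1 → ℝ) : -x = bpt (-x 0) := by
  funext i; rw [Subsingleton.elim i 0]; rfl

/-- Auxiliary step `aeval_negX_eq` (§B6): aeval neg X eq. [bookkeeping] -/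
theorem aeval_negX_eq (x : Fin 1 → ℝ) :
    (fun _ : Fin 1 => MvPolynomial.aeval x (-(MvPolynomial.X 0 : MvPolynomial (Fin 1) ℚ))) = -x := by
  funext j; rw [Subsingleton.elim j 0]; simp

/-- Auxiliary step `isSemialgebraic_reflect` (§B6): is Semialgebraic reflect. [bookkeeping] -/
theorem isSemialgebraic_reflect {T : Set (Fin 1 → ℝ)} (hT : IsSemialgebraic ℚ T) :
    IsSemialgebraic ℚ {x : Fin 1 → ℝ | -x ∈ T} := by
  have h := hT.preimage_aeval (fun _ : Fin 1 => -(MvPolynomial.X 0 : MvPolynomial (Fin 1) ℚ))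
  convert h using 1
  ext x
  simp only [mem_setOf_eq, mem_preimage, aeval_negX_eq]

/-- Auxiliary step `sa_comp_neg` (§B6): sa comp neg. [bookkeeping] -/
theorem sa_comp_neg {T : Set (Fin 1 → ℝ)} {f : (Fin 1 → ℝ) → ℝ} (hf : IsSemialgebraicFunOn ℚ T f) :
    IsSemialgebraicFunOn ℚ {x : Fin 1 → ℝ | -x ∈ T} (fun x => f (-x)) := by
  have h := hf.comp_aeval (fun _ : Fin 1 => -(MvPolynomial.X 0 : MvPolynomial (Fin 1) ℚ))
  convert h using 1
  · ext x; simp only [mem_setOf_eq, mem_preimage, aeval_negX_eq]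
  · funext x; rw [aeval_negX_eq]

/-- Integrability transports under the reflection of the line. -/
theorem integrableOn_reflect {S : Set (Fin 1 → ℝ)} (hS : MeasurableSet S) (g : (Fin 1 → ℝ) → ℝ) :
    IntegrableOn g {x | -x ∈ S} ↔ IntegrableOn (fun x => g (-x)) S := by
  set N := flipLin 1 (fun _ => (-1:ℝ)) with hNdef
  have hN : ∀ x : Fin 1 → ℝ, (N : (Fin 1 → ℝ) → (Fin 1 → ℝ)) x = -x := fun x => by
    funext i; rw [hNdef, flipLin_apply]; simp
  have hinv : ∀ x, N (N x) = x := fun x => by rw [hN, hN, neg_neg]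
  have himg : (N : (Fin 1 → ℝ) → (Fin 1 → ℝ)) '' S = {x | -x ∈ S} := by
    rw [Set.image_eq_preimage_of_inverse hinv hinv]
    ext x; simp only [mem_preimage, hN, mem_setOf_eq]
  have hdet : N.det = -1 := by rw [hNdef, det_flipLin]; simp
  have h := integrableOn_image_iff_integrableOn_abs_det_fderiv_smul volume hS
    (fun x _ => (N.hasFDerivAt).hasFDerivWithinAt)
    (fun x _ y _ hxy => by rw [← hinv x, ← hinv y]; exact congrArg N hxy) g
  rw [himg] at h
  rw [h]
  refine integrableOn_congr_fun (fun x _ => ?_) hS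
  rw [hdet, hN]; simp

/-- **Reflection of an arctangent monomial.** `⟦band T 0 u ; p⟧ = ⟦band (-T) 0 (u ∘ neg) ; p ∘ neg⟧` in `𝒫_KZ`. -/
theorem reflect_rep {T : Set (Fin 1 → ℝ)} (hT : IsSemialgebraic ℚ T) {p u : (Fin 1 → ℝ) → ℝ}
    (hp : IsSemialgebraicFunOn ℚ T p) (hu : IsSemialgebraicFunOn ℚ T u) (hu0 : ∀ x ∈ T, 0 ≤ u x)
    (A : KZ.IntegralRep 2) (hAd : A.domain = KZlog.band T (fun _ => 0) u)
    (hAi : EqOn A.integrand (fun z => p (Fin.init z) / (1 + z (Fin.last 1) ^ 2)) A.domain)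
    (hint : IntegrableOn (fun x => p x * Real.arctan (u x)) T) :
    ∃ A' : KZ.IntegralRep 2, A'.domain = KZlog.band {x : Fin 1 → ℝ | -x ∈ T} (fun _ => 0) (fun x => u (-x)) ∧
      A'.integrand = (fun z => p (-Fin.init z) / (1 + z (Fin.last 1) ^ 2)) ∧ cl A = cl A' := by
  have hTm : MeasurableSet T := IsSemialgebraic.measurableSet_holds hT
  have hT's : IsSemialgebraic ℚ {x : Fin 1 → ℝ | -x ∈ T} := isSemialgebraic_reflect hT
  have hp' := sa_comp_neg hp
  have hu' := sa_comp_neg hu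
  have hu0' : ∀ x ∈ {x : Fin 1 → ℝ | -x ∈ T}, 0 ≤ u (-x) := fun x hx => hu0 _ hx
  have hint' : IntegrableOn (fun x => p (-x) * Real.arctan (u (-x))) {x : Fin 1 → ℝ | -x ∈ T} :=
    (integrableOn_reflect hTm (fun x => p (-x) * Real.arctan (u (-x)))).2 (by simpa only [neg_neg] using hint)
  let A' : KZ.IntegralRep 2 := arctanRep hT's hu' hp' hu0' hint'
  refine ⟨A', rfl, rfl, ?_⟩
  set Φ := flipLin 2 ![-1, 1] with hΦdef
  have hinit : ∀ z : Fin 2 → ℝ, Fin.init (Φ z) = -Fin.init z := fun z => by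
    funext i; rw [Subsingleton.elim i 0]; simp only [Fin.init, Pi.neg_apply, hΦdef, flipLin_apply]; simp
  have hlast : ∀ z : Fin 2 → ℝ, Φ z (Fin.last 1) = z (Fin.last 1) := fun z => by
    rw [hΦdef, flipLin_apply]; simp [show (Fin.last 1 : Fin 2) = 1 from rfl]
  have hinv : ∀ z, Φ (Φ z) = z := fun z => by
    funext i; rw [hΦdef, flipLin_apply, flipLin_apply]
    fin_cases i <;> simp
  have hdet : |Φ.det| = 1 := by rw [hΦdef, det_flipLin]; simp [Fin.prod_univ_two]
  apply mk_sub_eq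
  refine KZ.changeOfVariablesRel_subset_relations ⟨2, A, A', Φ, fun _ => Φ, ?_,
    fun z _ => (Φ.hasFDerivAt).hasFDerivWithinAt, ?_, ?_, ?_, rfl⟩
  · refine (isSemialgebraicMapOn_aeval A.isSemialgebraic_domain
      ![-(MvPolynomial.X 0 : MvPolynomial (Fin 2) ℚ), MvPolynomial.X 1]).congr fun z _ => ?_
    funext i; rw [hΦdef, flipLin_apply]
    fin_cases i <;> simp
  · intro z₁ _ z₂ _ h
    rw [← hinv z₁, ← hinv z₂]; exact congrArg Φ h
  · show KZlog.band {x : Fin 1 → ℝ | -x ∈ T} (fun _ => 0) (fun x => u (-x)) = Φ '' A.domain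
    rw [Set.image_eq_preimage_of_inverse hinv hinv, hAd]
    ext w
    simp only [KZlog.mem_band, mem_preimage, mem_setOf_eq, hinit, hlast]
  · intro z hz
    rw [hAi hz, hdet, mul_one]
    show p (Fin.init z) / (1 + z (Fin.last 1) ^ 2) = p (-Fin.init (Φ z)) / (1 + (Φ z) (Fin.last 1) ^ 2)
    rw [hinit, hlast, neg_neg]

/-- **The bottom half-cell theorem**: `half_top` transported along `x ↦ -x`. -/
theorem half_bot {T : Set (Fin 1 → ℝ)} (hT : IsSemialgebraic ℚ T) (hTo : IsOpen T) (hTc : OrdConv T)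
    (hne : T.Nonempty) {l : ℕ} {p u : Fin l → (Fin 1 → ℝ) → ℝ}
    (hp : ∀ j, IsSemialgebraicFunOn ℚ T (p j)) (hu : ∀ j, IsSemialgebraicFunOn ℚ T (u j))
    (hu0 : ∀ j, ∀ x ∈ T, 0 ≤ u j x) (hud : ∀ j, ∀ x ∈ T, DifferentiableAt ℝ (u j) x)
    (hsgn : ∀ j, (∀ x ∈ T, du (u j) x = 0) ∨ (∀ x ∈ T, du (u j) x < 0) ∨ (∀ x ∈ T, 0 < du (u j) x))
    (hone : ∀ j, (∀ x ∈ T, u j x ≤ 1) ∨ (∀ x ∈ T, 1 ≤ u j x))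
    (A : Fin l → KZ.IntegralRep 2) (hAd : ∀ j, (A j).domain = KZlog.band T (fun _ => 0) (u j))
    (hAi : ∀ j, EqOn (A j).integrand (fun z => p j (Fin.init z) / (1 + z (Fin.last 1) ^ 2)) (A j).domain)
    (hint : ∀ j, IntegrableOn (fun x => p j x * Real.arctan (u j x)) T)
    (hloc : ∀ j, ∀ x₁ ∈ T, IntegrableOn (p j) {x | x ∈ T ∧ x₁ 0 ≤ x 0})
    {S : ℕ} (f' : Fin S → Fin l → ℤ) (m : Fin S → ℚ) (q' : Fin S → (Fin 1 → ℝ) → ℝ)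
    (hrel : ∀ s, ∀ x ∈ T, ∑ j, (f' s j : ℝ) * Real.arctan (u j x) = (m s : ℝ) * Real.pi)
    (hbud : ∀ x ∈ T, ∑ s, q' s x * (m s : ℝ) = 0)
    (hpq : ∀ j, ∀ x ∈ T, p j x = ∑ s, q' s x * (f' s j : ℝ)) :
    ∑ j, KZ.of (A j) ∈ KZ.relations := by
  have hTm : MeasurableSet T := IsSemialgebraic.measurableSet_holds hT
  choose A' hA'd hA'i hcl using fun j => reflect_rep hT (hp j) (hu j) (hu0 j) (A j) (hAd j) (hAi j) (hint j)
  suffices h : ∑ j, KZ.of (A' j) ∈ KZ.relations by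
    have h1 : ∑ j, cl (A' j) = 0 := by
      have := (mk_eq_zero_iff).2 h
      rw [map_sum] at this
      exact this
    apply (mk_eq_zero_iff).1
    rw [map_sum]
    show ∑ j, cl (A j) = 0
    rw [Finset.sum_congr rfl fun j _ => hcl j]
    exact h1
  set T' : Set (Fin 1 → ℝ) := {x | -x ∈ T} with hT'def
  have hT's : IsSemialgebraic ℚ T' := isSemialgebraic_reflect hT
  have hTo' : IsOpen T' := hTo.preimage continuous_neg
  have hTc' : OrdConv T' := by
    intro x hx y hy r hxr hry
    have h := hTc (-y) hy (-x) hx (-r) (by simp only [Pi.neg_apply]; linarith) (by simp only [Pi.neg_apply]; linarith)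
    show -bpt r ∈ T
    rw [show -bpt r = bpt (-r) from by funext i; simp [bpt]]
    exact h
  have hne' : T'.Nonempty := by
    obtain ⟨x, hx⟩ := hne
    exact ⟨-x, show -(-x) ∈ T by rw [neg_neg]; exact hx⟩
  have hud' : ∀ j, ∀ x ∈ T', DifferentiableAt ℝ (fun y => u j (-y)) x :=
    fun j x hx => (hud j (-x) hx).comp x (differentiableAt_id.neg)
  have hdu' : ∀ j, ∀ x ∈ T', du (fun y => u j (-y)) x = -du (u j) (-x) := by
    intro j x hx
    have h : HasFDerivAt (fun y => u j (-y))
        ((fderiv ℝ (u j) (-x)).comp (-(ContinuousLinearMap.id ℝ (Fin 1 → ℝ)))) x :=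
      (hud j (-x) hx).hasFDerivAt.comp x ((hasFDerivAt_id x).neg)
    show fderiv ℝ (fun y => u j (-y)) x (Pi.single 0 1) = -(fderiv ℝ (u j) (-x) (Pi.single 0 1))
    rw [h.fderiv]
    simp
  have hsgn' : ∀ j, (∀ x ∈ T', du (fun y => u j (-y)) x = 0) ∨ (∀ x ∈ T', du (fun y => u j (-y)) x < 0) ∨
      (∀ x ∈ T', 0 < du (fun y => u j (-y)) x) := fun j =>
    (hsgn j).imp (fun h x hx => by rw [hdu' j x hx, h (-x) hx, neg_zero]) fun h' =>
      h'.symm.imp (fun h x hx => by rw [hdu' j x hx]; linarith [h (-x) hx])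
        (fun h x hx => by rw [hdu' j x hx]; linarith [h (-x) hx])
  have hone' : ∀ j, (∀ x ∈ T', u j (-x) ≤ 1) ∨ (∀ x ∈ T', 1 ≤ u j (-x)) := fun j =>
    (hone j).imp (fun h x hx => h (-x) hx) (fun h x hx => h (-x) hx)
  have hint' : ∀ j, IntegrableOn (fun x => p j (-x) * Real.arctan (u j (-x))) T' := fun j =>
    (integrableOn_reflect hTm (fun x => p j (-x) * Real.arctan (u j (-x)))).2
      (by simpa only [neg_neg] using hint j)
  have hloc' : ∀ j, ∀ x₁ ∈ T', IntegrableOn (fun x => p j (-x)) {x | x ∈ T' ∧ x 0 ≤ x₁ 0} := by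
    intro j x₁ hx₁
    have hSm : MeasurableSet {y : Fin 1 → ℝ | y ∈ T ∧ (-x₁) 0 ≤ y 0} :=
      hTm.inter (measurableSet_le measurable_const (measurable_pi_apply 0))
    have hS : {x | x ∈ T' ∧ x 0 ≤ x₁ 0} = {x | -x ∈ {y : Fin 1 → ℝ | y ∈ T ∧ (-x₁) 0 ≤ y 0}} := by
      ext x
      simp only [mem_setOf_eq, Pi.neg_apply, neg_le_neg_iff, hT'def]
    rw [hS]
    exact (integrableOn_reflect hSm (fun x => p j (-x))).2 (by simpa only [neg_neg] using hloc j (-x₁) hx₁)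
  exact half_top hT's hTo' hTc' hne' (fun j => sa_comp_neg (hp j)) (fun j => sa_comp_neg (hu j))
    (fun j x hx => hu0 j (-x) hx) hud' hsgn' hone' A' hA'd (fun j z _ => by rw [hA'i j]) hint' hloc' f' m
    (fun s x => q' s (-x)) (fun s x hx => hrel s (-x) hx) (fun x hx => hbud (-x) hx) (fun j x hx => hpq j (-x) hx)

/-! ### §F Cells: interval cells, the rational cut, the smooth locus; the main theorem. -/

end AngleFold
end Summit.KontsevichZagierPeriods.RootDecompRelativeModAbsolute.Rung30571.RegularisedLogLayer.CylLog.Leaf.G13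
end
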